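import Mathlib
import Summits.MatrixMultiplication.MatrixMultiplication.Theses.LevelGradedCohnUmans
import Literature.RepresentationTheory.FiniteGroups.IrreducibleCharacters
import Summits.MatrixMultiplication.MatrixMultiplication.Theorems.LevelGradedCohnUmansGradedDesignFamilyStubPowerSep
import Summits.MatrixMultiplication.MatrixMultiplication.Theorems.LevelGradedCohnUmansGradedDesignFamilyStubProdBudget
import Summits.MatrixMultiplication.MatrixMultiplication.Theorems.LevelGradedCohnUmansGradedDesignFamilyStubPowerBudget
import Summits.MatrixMultiplication.MatrixMultiplication.Theorems.LevelGradedCohnUmansGradedDesignFamilyStubWreathSep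
import Summits.MatrixMultiplication.MatrixMultiplication.Theorems.LevelGradedCohnUmansGradedDesignFamilyStubWreathBudget
import Summits.MatrixMultiplication.MatrixMultiplication.Theorems.LevelGradedCohnUmansGradedDesignFamilyStubAmplify

/-!
# The graded Cohn–Kleinberg–Szegedy–Umans wreath lift:
# graded simultaneous (STPP) families ⇔ `GradedDesignFamily`

Route `LevelGradedCohnUmans`, crux `GradedDesignFamily` (stmt-MatrixMultiplication-7610), line `Sketch`
(cards `graded-stpp-wreath` ≈ `graded-simultaneity-wreath-lift`).  This file is the line's TRANSFER
as a sorry-free theorem: the crux is EQUIVALENT to the existence, for every `ε > 0`, of a finite group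
`G`, a bi-invariant test space `J ≤ ℂ^G` and a SIMULTANEOUSLY `J`-separated family of `t` pieces
`(X_i, Y_i, Z_i)` whose total `Σ_i (|X_i||Y_i||Z_i|)^{(2+ε)/3}` beats the graded budget
`Σ_{χ ∈ Irr G ∩ J} χ(1)^{2+ε}` (`gradedDesignFamily_iff_simultaneousFamily`).

* `gradedWreathLink_proof` — families ⇒ crux: direct power `G^N` with `J^{⊠N}` (`stub_powerSep`,
  `stub_powerBudget ∘ stub_prodBudget`), restriction to one multinomial type class `T` of words
  (`stub_amplify`: `(M!)^{s-1}(B^N)^M < ((M!)^3 Π_{w∈T} V_w)^{s/3}`), and the CKSU wreath step in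
  `(T → G^N) ⋊ Perm T` (`stub_wreathSep`, `stub_wreathBudget`: budget `≤ (M!)^{s-1}·budget(base)`).
  [cite: CohnKleinbergSzegedyUmans2005, Thm. 7.1]
* `simultaneousFamily_of_gradedDesignFamily` — crux ⇒ families (a single design is a one-piece family).

All six ingredients are landed helper files of this line (`…GradedDesignFamilyStub*.lean`).
-/

noncomputable section

set_option linter.dupNamespace false

open scoped BigOperators
open Literature.RepresentationTheory.FiniteGroups
open Summit.MatrixMultiplication.MatrixMultiplication.Theses.LevelGradedCohnUmans

namespace Summit.MatrixMultiplication.MatrixMultiplication.Theorems.GradedDesignFamily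

/-- Restricting a simultaneously separated family along an injection of index types keeps it
simultaneously separated. -/
theorem simSep_restrict {G : Type} [Group G] {ι ι' : Type} (J : Set (G → ℂ))
    (X Y Z : ι → Finset G) (e : ι' → ι) (he : Function.Injective e)
    (hsep : ∀ i : ι, ∀ x₀ ∈ X i, ∀ z₀ ∈ Z i, ∃ f ∈ J, ∀ a b : ι, ∀ x ∈ X a, ∀ y ∈ Y a, ∀ y' ∈ Y b,
      ∀ z ∈ Z b, ((a = i ∧ b = i ∧ x = x₀ ∧ y = y' ∧ z = z₀) → f (x⁻¹ * y * y'⁻¹ * z) = 1) ∧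
        (¬ (a = i ∧ b = i ∧ x = x₀ ∧ y = y' ∧ z = z₀) → f (x⁻¹ * y * y'⁻¹ * z) = 0)) :
    ∀ i : ι', ∀ x₀ ∈ X (e i), ∀ z₀ ∈ Z (e i), ∃ f ∈ J, ∀ a b : ι', ∀ x ∈ X (e a), ∀ y ∈ Y (e a),
      ∀ y' ∈ Y (e b), ∀ z ∈ Z (e b),
        ((a = i ∧ b = i ∧ x = x₀ ∧ y = y' ∧ z = z₀) → f (x⁻¹ * y * y'⁻¹ * z) = 1) ∧
        (¬ (a = i ∧ b = i ∧ x = x₀ ∧ y = y' ∧ z = z₀) → f (x⁻¹ * y * y'⁻¹ * z) = 0) := by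
  intro i x₀ hx₀ z₀ hz₀
  obtain ⟨f, hf, hfs⟩ := hsep (e i) x₀ hx₀ z₀ hz₀
  refine ⟨f, hf, fun a b x hx y hy y' hy' z hz => ?_⟩
  obtain ⟨h1, h0⟩ := hfs (e a) (e b) x hx y hy y' hy' z hz
  refine ⟨fun h => h1 ⟨by rw [h.1], by rw [h.2.1], h.2.2⟩, fun h => h0 ?_⟩
  rintro ⟨ha, hb, hrest⟩
  exact h ⟨he ha, he hb, hrest⟩

/-- Cardinality of the CKSU lift `(Π_j A_j) × Perm ι ↪ (ι → H) ⋊ Perm ι`. -/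
theorem card_lift {H : Type} [Group H] [DecidableEq H] {ι : Type} [Fintype ι] [DecidableEq ι]
    (A : ι → Finset H) :
    (((Fintype.piFinset A) ×ˢ (Finset.univ : Finset (Equiv.Perm ι))).map
        (SemidirectProduct.equivProd (N := ι → H) (G := Equiv.Perm ι)
          (φ := mulAutArrow)).symm.toEmbedding).card =
      (∏ j, (A j).card) * (Fintype.card ι).factorial := by
  rw [Finset.card_map, Finset.card_product, Fintype.card_piFinset, Finset.card_univ,
    Fintype.card_perm]

/-- **The graded CKSU wreath lift** (card `graded-stpp-wreath`, first lemma `gradedWreathLink`):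
graded simultaneous families for every `ε > 0` imply `GradedDesignFamily`.  Engine family →
(`stub_amplify`) a power `N` and a type class `T` of words → (`stub_powerSep`,
`stub_powerBudget ∘ stub_prodBudget`) the power family in `G^N` restricted to `T` →
(`stub_wreathSep`, `stub_wreathBudget`) one `J_wr`-separated triple in `(T → G^N) ⋊ Perm T` whose
graded budget is `≤ (M!)^{1+ε} (B^N)^M < V'^{(2+ε)/3}`. [cite: CohnKleinbergSzegedyUmans2005, Thm. 7.1] -/
theorem gradedWreathLinkAt (ε : ℝ) (hε : 0 ≤ ε)
    (hfam : ∃ (G : Type) (_ : Group G) (_ : Fintype G)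
      (J : Submodule ℂ (G → ℂ)) (t : ℕ) (X Y Z : Fin t → Finset G),
      (∀ f ∈ J, ∀ a b : G, (fun g : G => f (a * g * b)) ∈ J) ∧
      (∀ i : Fin t, ∀ x₀ ∈ X i, ∀ z₀ ∈ Z i, ∃ f ∈ J, ∀ a b : Fin t, ∀ x ∈ X a, ∀ y ∈ Y a,
        ∀ y' ∈ Y b, ∀ z ∈ Z b,
          ((a = i ∧ b = i ∧ x = x₀ ∧ y = y' ∧ z = z₀) → f (x⁻¹ * y * y'⁻¹ * z) = 1) ∧
          (¬ (a = i ∧ b = i ∧ x = x₀ ∧ y = y' ∧ z = z₀) → f (x⁻¹ * y * y'⁻¹ * z) = 0)) ∧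
      (∑ᶠ χ ∈ irrChars G ∩ (J : Set (G → ℂ)), (χ 1).re ^ (2 + ε)) <
        ∑ i, (((X i).card * (Y i).card * (Z i).card : ℕ) : ℝ) ^ ((2 + ε) / 3)) :
    ∃ (G : Type) (_ : Group G) (_ : Fintype G) (J : Submodule ℂ (G → ℂ)) (X Y Z : Finset G),
      (∀ f ∈ J, ∀ a b : G, (fun g : G => f (a * g * b)) ∈ J) ∧
      (∀ x₀ ∈ X, ∀ z₀ ∈ Z, ∃ f ∈ J, ∀ x ∈ X, ∀ y ∈ Y, ∀ y' ∈ Y, ∀ z ∈ Z,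
        (x = x₀ ∧ y = y' ∧ z = z₀ → f (x⁻¹ * y * y'⁻¹ * z) = 1) ∧
        (¬ (x = x₀ ∧ y = y' ∧ z = z₀) → f (x⁻¹ * y * y'⁻¹ * z) = 0)) ∧
      (∑ᶠ χ ∈ Literature.RepresentationTheory.FiniteGroups.irrChars G ∩ (J : Set (G → ℂ)),
        (χ 1).re ^ (2 + ε)) < ((X.card * Y.card * Z.card : ℕ) : ℝ) ^ ((2 + ε) / 3) := by
  classical
  obtain ⟨G, instG, instF, J, t, X, Y, Z, hJ, hsep, hlt⟩ := hfam
  -- the exponent and the base budget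
  set s : ℝ := 2 + ε with hs_def
  have hs2 : (2 : ℝ) ≤ s := by rw [hs_def]; linarith [hε]
  have hB0 : 0 ≤ ∑ᶠ χ ∈ irrChars G ∩ (J : Set (G → ℂ)), (χ 1).re ^ s :=
    powerBudget_nonneg (J : Set (G → ℂ)) s
  -- volumes of the pieces
  set v : Fin t → ℝ := fun i => (((X i).card * (Y i).card * (Z i).card : ℕ) : ℝ) with hv_def
  have hv : ∀ i, 0 ≤ v i := fun i => by rw [hv_def]; exact Nat.cast_nonneg _
  have hlt' : (∑ᶠ χ ∈ irrChars G ∩ (J : Set (G → ℂ)), (χ 1).re ^ s) < ∑ i, v i ^ (s / 3) := by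
    rw [hv_def, hs_def]; exact hlt
  -- Stub 6: the power `N` and the type class `T` of words
  obtain ⟨N, T, hamp⟩ := stub_amplify t s _ hB0 v hv hlt'
  -- Stub 1: the power family in `G^N`
  obtain ⟨hJN, hsepN⟩ := stub_powerSep (ι := Fin t) (κ := Fin N) J hJ X Y Z hsep
  set JN : Submodule ℂ ((Fin N → G) → ℂ) := Submodule.span ℂ {F : (Fin N → G) → ℂ |
    ∃ g : Fin N → (G → ℂ), (∀ k, g k ∈ J) ∧ F = fun h => ∏ k, g k (h k)} with hJN_def
  -- restrict to the words of `T`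
  have hsepT := simSep_restrict (JN : Set ((Fin N → G) → ℂ))
    (fun w : Fin N → Fin t => Fintype.piFinset fun k => X (w k))
    (fun w => Fintype.piFinset fun k => Y (w k)) (fun w => Fintype.piFinset fun k => Z (w k))
    (fun w : ↥T => (w : Fin N → Fin t)) Subtype.coe_injective hsepN
  -- Stub 4: the wreath step over the index type `↥T`
  obtain ⟨hJW, hsepW⟩ := stub_wreathSep (ι := ↥T) JN hJN
    (fun w : ↥T => Fintype.piFinset fun k => X ((w : Fin N → Fin t) k))
    (fun w => Fintype.piFinset fun k => Y ((w : Fin N → Fin t) k))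
    (fun w => Fintype.piFinset fun k => Z ((w : Fin N → Fin t) k)) hsepT
  -- the witness
  let W : Type := (↥T → (Fin N → G)) ⋊[mulAutArrow] Equiv.Perm ↥T
  letI : Fintype W := Fintype.ofEquiv _ (SemidirectProduct.equivProd (N := ↥T → (Fin N → G))
    (G := Equiv.Perm ↥T) (φ := mulAutArrow)).symm
  refine ⟨W, inferInstance, inferInstance, _, _, _, _, hJW, hsepW, ?_⟩
  -- budget chain
  have h5 := stub_wreathBudget (ι := ↥T) JN hJN s hs2
  have h3T := stub_powerBudget (κ := ↥T) JN s
    (fun K L _ _ _ _ _ _ JK JL => stub_prodBudget K L JK JL s)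
  have h3N := stub_powerBudget (κ := Fin N) J s
    (fun K L _ _ _ _ _ _ JK JL => stub_prodBudget K L JK JL s)
  rw [Fintype.card_fin] at h3N
  rw [Fintype.card_coe] at h5 h3T
  have hBN0 : 0 ≤ ∑ᶠ χ ∈ irrChars (Fin N → G) ∩ (JN : Set ((Fin N → G) → ℂ)), (χ 1).re ^ s :=
    powerBudget_nonneg _ s
  have hfac0 : (0 : ℝ) ≤ ((T.card.factorial : ℕ) : ℝ) ^ (s - 1) := Real.rpow_nonneg (Nat.cast_nonneg _) _
  have hchain : (∑ᶠ χ ∈ irrChars W ∩ _, (χ 1).re ^ s) ≤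
      ((T.card.factorial : ℕ) : ℝ) ^ (s - 1) *
        ((∑ᶠ χ ∈ irrChars G ∩ (J : Set (G → ℂ)), (χ 1).re ^ s) ^ N) ^ T.card :=
    h5.trans (mul_le_mul_of_nonneg_left (h3T.trans (pow_le_pow_left₀ hBN0 h3N _)) hfac0)
  refine lt_of_le_of_lt hchain (lt_of_lt_of_eq hamp ?_)
  -- volumes
  congr 1
  rw [card_lift, card_lift, card_lift]
  simp only [Fintype.card_piFinset, Fintype.card_coe]
  rw [hv_def]
  push_cast
  rw [← Finset.prod_coe_sort T]
  simp only [Finset.prod_mul_distrib]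
  ring


/-- **The graded CKSU wreath lift, global form**: graded simultaneous families for every `ε > 0`
imply `GradedDesignFamily`. [cite: CohnKleinbergSzegedyUmans2005, Thm. 7.1] -/
theorem gradedWreathLink_proof
    (hfam : ∀ ε : ℝ, 0 < ε → ∃ (G : Type) (_ : Group G) (_ : Fintype G)
      (J : Submodule ℂ (G → ℂ)) (t : ℕ) (X Y Z : Fin t → Finset G),
      (∀ f ∈ J, ∀ a b : G, (fun g : G => f (a * g * b)) ∈ J) ∧
      (∀ i : Fin t, ∀ x₀ ∈ X i, ∀ z₀ ∈ Z i, ∃ f ∈ J, ∀ a b : Fin t, ∀ x ∈ X a, ∀ y ∈ Y a,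
        ∀ y' ∈ Y b, ∀ z ∈ Z b,
          ((a = i ∧ b = i ∧ x = x₀ ∧ y = y' ∧ z = z₀) → f (x⁻¹ * y * y'⁻¹ * z) = 1) ∧
          (¬ (a = i ∧ b = i ∧ x = x₀ ∧ y = y' ∧ z = z₀) → f (x⁻¹ * y * y'⁻¹ * z) = 0)) ∧
      (∑ᶠ χ ∈ irrChars G ∩ (J : Set (G → ℂ)), (χ 1).re ^ (2 + ε)) <
        ∑ i, (((X i).card * (Y i).card * (Z i).card : ℕ) : ℝ) ^ ((2 + ε) / 3)) :
    GradedDesignFamily := fun ε hε => gradedWreathLinkAt ε hε.le (hfam ε hε)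

/-- The trivial direction of the transfer: a single graded design is a one-piece simultaneous family
(`t = 1`), so `GradedDesignFamily` implies the family statement. [folklore] -/
theorem simultaneousFamily_of_gradedDesignFamily (h : GradedDesignFamily) :
    (∀ ε : ℝ, 0 < ε → ∃ (G : Type) (_ : Group G) (_ : Fintype G)
      (J : Submodule ℂ (G → ℂ)) (t : ℕ) (X Y Z : Fin t → Finset G),
      (∀ f ∈ J, ∀ a b : G, (fun g : G => f (a * g * b)) ∈ J) ∧
      (∀ i : Fin t, ∀ x₀ ∈ X i, ∀ z₀ ∈ Z i, ∃ f ∈ J, ∀ a b : Fin t, ∀ x ∈ X a, ∀ y ∈ Y a,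
        ∀ y' ∈ Y b, ∀ z ∈ Z b,
          ((a = i ∧ b = i ∧ x = x₀ ∧ y = y' ∧ z = z₀) → f (x⁻¹ * y * y'⁻¹ * z) = 1) ∧
          (¬ (a = i ∧ b = i ∧ x = x₀ ∧ y = y' ∧ z = z₀) → f (x⁻¹ * y * y'⁻¹ * z) = 0)) ∧
      (∑ᶠ χ ∈ irrChars G ∩ (J : Set (G → ℂ)), (χ 1).re ^ (2 + ε)) <
        ∑ i, (((X i).card * (Y i).card * (Z i).card : ℕ) : ℝ) ^ ((2 + ε) / 3)) := by
  intro ε hε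
  obtain ⟨G, hG, hF, J, X, Y, Z, hJ, hsep, hlt⟩ := h ε hε
  refine ⟨G, hG, hF, J, 1, (fun _ => X), (fun _ => Y), (fun _ => Z), hJ, ?_, ?_⟩
  · intro i x₀ hx₀ z₀ hz₀
    obtain ⟨f, hf, hfsep⟩ := hsep x₀ hx₀ z₀ hz₀
    refine ⟨f, hf, ?_⟩
    intro a b x hx y hy y' hy' z hz
    have ha : a = i := Subsingleton.elim a i
    have hb : b = i := Subsingleton.elim b i
    obtain ⟨h1, h0⟩ := hfsep x hx y hy y' hy' z hz
    refine ⟨fun hh => h1 ⟨hh.2.2.1, hh.2.2.2.1, hh.2.2.2.2⟩, fun hh => h0 ?_⟩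
    rintro ⟨hx', hy'', hz'⟩
    exact hh ⟨ha, hb, hx', hy'', hz'⟩
  · simpa using hlt

/-- **The crux is EQUIVALENT to the graded simultaneous-family statement** (`C⁺` of the line):
`GradedDesignFamily ↔ ∀ ε > 0, ∃` a bi-invariant `J` and a simultaneously `J`-separated family
beating the graded budget in total. [cite: CohnKleinbergSzegedyUmans2005, Thm. 7.1] -/
theorem gradedDesignFamily_iff_simultaneousFamily :
    GradedDesignFamily ↔ (∀ ε : ℝ, 0 < ε → ∃ (G : Type) (_ : Group G) (_ : Fintype G)
      (J : Submodule ℂ (G → ℂ)) (t : ℕ) (X Y Z : Fin t → Finset G),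
      (∀ f ∈ J, ∀ a b : G, (fun g : G => f (a * g * b)) ∈ J) ∧
      (∀ i : Fin t, ∀ x₀ ∈ X i, ∀ z₀ ∈ Z i, ∃ f ∈ J, ∀ a b : Fin t, ∀ x ∈ X a, ∀ y ∈ Y a,
        ∀ y' ∈ Y b, ∀ z ∈ Z b,
          ((a = i ∧ b = i ∧ x = x₀ ∧ y = y' ∧ z = z₀) → f (x⁻¹ * y * y'⁻¹ * z) = 1) ∧
          (¬ (a = i ∧ b = i ∧ x = x₀ ∧ y = y' ∧ z = z₀) → f (x⁻¹ * y * y'⁻¹ * z) = 0)) ∧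
      (∑ᶠ χ ∈ irrChars G ∩ (J : Set (G → ℂ)), (χ 1).re ^ (2 + ε)) <
        ∑ i, (((X i).card * (Y i).card * (Z i).card : ℕ) : ℝ) ^ ((2 + ε) / 3)) :=
  ⟨simultaneousFamily_of_gradedDesignFamily, gradedWreathLink_proof⟩

end Summit.MatrixMultiplication.MatrixMultiplication.Theorems.GradedDesignFamily

end
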